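import Literature.Topology.FourManifolds.SphereMorseCount
import Literature.Topology.FourManifolds.ClosedBallProofs
import HarnessLib

/-!
# Configurations of Schultens' Schönflies induction and their covariance

Topic `Literature/Topology/FourManifolds`; Schultens, *Introduction to 3-Manifolds* (2014),
Thm. 3.2.5 (PDF pp. 43–45).  The printed proof works with a smooth sphere `S ⊂ ℝ³` whose height
function is Morse and inducts on the number of saddles.  In this development a stage of the
induction is a **configuration** `(F, f)`: a smooth proper-below defining function `F` of the
compact solid `A = {F ≤ 0}` with regular boundary `S = {F = 0} = f(𝕊²)`, `f` a smooth embedding,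
connected interior and exterior, and Morse height `⟪e₂, f ·⟫` (`Config`); its complexity is the
number of saddles `saddles f` (critical points of index `1` of the height).

This file fixes the structure and proves its **covariance**: along a diffeomorphism `Ψ` of `ℝ³`
acting on heights affinely, `(Ψ x)₂ = σ x₂ + τ` with `σ = ±1` (translations, horizontal
similarities, the reflection `x₂ ↦ -x₂`, the level-preserving straightening moves), the pair
`(F ∘ Ψ⁻¹, Ψ ∘ f)` is again a configuration with the same number of saddles
(`Config.transport`, `saddles_transport`); Milnor's turning-about
(`IsMorse.morseIndex_const_sub_add`) handles `σ = -1`.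

## References
* J. Schultens, *Introduction to 3-Manifolds*, GSM 151, AMS (2014), Thm. 3.2.5.
* J. Milnor, *Lectures on the h-cobordism theorem* (1965), proof of Thm. 9.1.
-/

noncomputable section

open Set Metric Filter Topology
open scoped Manifold ContDiff RealInnerProductSpace

namespace Literature.Topology.FourManifolds.SchoenfliesConfig

/-- The height `⟪e₂, f ·⟫` of a map to `ℝ³`. [cite: Schultens2014, proof of Thm. 3.2.5 (PDF p. 43)] -/
def height {X : Type*} (f : X → EuclideanSpace ℝ (Fin 3)) : X → ℝ :=
  fun y => ⟪EuclideanSpace.single (2 : Fin 3) (1 : ℝ), f y⟫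

/-- `height f y = (f y)₂`. [folklore] -/
theorem height_apply {X : Type*} (f : X → EuclideanSpace ℝ (Fin 3)) (y : X) :
    height f y = (f y) 2 := by
  simp [height, EuclideanSpace.inner_single_left]

/-- **Configuration** of the Schönflies induction: `A = {F ≤ 0}` compact with regular boundary
the embedded sphere `f(𝕊²) = {F = 0}`, connected interior `{F < 0}` and exterior `{0 < F}`, and
Morse height function on the sphere. [cite: Schultens2014, proof of Thm. 3.2.5 (PDF pp. 43–45)] -/
structure Config (F : EuclideanSpace ℝ (Fin 3) → ℝ)
    (f : sphere (0 : EuclideanSpace ℝ (Fin 3)) 1 → EuclideanSpace ℝ (Fin 3)) : Prop where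
  smooth : ContDiff ℝ ∞ F
  proper : ∃ ε : ℝ, 0 < ε ∧ IsCompact {x | F x ≤ ε}
  reg : ∀ x, F x = 0 → fderiv ℝ F x ≠ 0
  emb : Manifold.IsSmoothEmbedding (𝓡 2) 𝓘(ℝ, EuclideanSpace ℝ (Fin 3)) ∞ f
  range_eq : range f = {x | F x = 0}
  conn_pos : IsConnected {x | 0 < F x}
  conn_neg : IsConnected {x | F x < 0}
  morse : IsMorse (𝓡 2) (height f)

/-- The number of saddles of the height function. [cite: Schultens2014, proof of Thm. 3.2.5 (PDF p. 44)] -/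
def saddles (f : sphere (0 : EuclideanSpace ℝ (Fin 3)) 1 → EuclideanSpace ℝ (Fin 3)) : ℕ :=
  (criticalSetOfIndex (𝓡 2) (height f) 1).ncard

/-- **Height-affine diffeomorphism**: `(Ψ x)₂ = σ x₂ + τ` with `σ = 1` or `σ = -1`. [folklore] -/
def HeightAffine (Ψ : EuclideanSpace ℝ (Fin 3) ≃ₘ⟮𝓘(ℝ, EuclideanSpace ℝ (Fin 3)),
    𝓘(ℝ, EuclideanSpace ℝ (Fin 3))⟯ EuclideanSpace ℝ (Fin 3)) (σ τ : ℝ) : Prop :=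
  (σ = 1 ∨ σ = -1) ∧ ∀ x, (Ψ x) 2 = σ * x 2 + τ

/-! ### §1 Covariance -/

section Transport

variable {F : EuclideanSpace ℝ (Fin 3) → ℝ}
  {f : sphere (0 : EuclideanSpace ℝ (Fin 3)) 1 → EuclideanSpace ℝ (Fin 3)}
  (Ψ : EuclideanSpace ℝ (Fin 3) ≃ₘ⟮𝓘(ℝ, EuclideanSpace ℝ (Fin 3)),
    𝓘(ℝ, EuclideanSpace ℝ (Fin 3))⟯ EuclideanSpace ℝ (Fin 3))

/-- The transported solid: `{F ∘ Ψ⁻¹ ≤ c} = Ψ({F ≤ c})`, and likewise for `=`, `<`. [folklore] -/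
theorem setOf_comp_symm_le (c : ℝ) : {y | (F ∘ Ψ.symm) y ≤ c} = Ψ '' {x | F x ≤ c} := by
  ext y; constructor
  · intro hy; exact ⟨Ψ.symm y, hy, Ψ.apply_symm_apply y⟩
  · rintro ⟨x, hx, rfl⟩; simpa [Function.comp] using hx

/-- `{F ∘ Ψ⁻¹ = c} = Ψ({F = c})`. [folklore] -/
theorem setOf_comp_symm_eq (c : ℝ) : {y | (F ∘ Ψ.symm) y = c} = Ψ '' {x | F x = c} := by
  ext y; constructor
  · intro hy; exact ⟨Ψ.symm y, hy, Ψ.apply_symm_apply y⟩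
  · rintro ⟨x, hx, rfl⟩; simpa [Function.comp] using hx

/-- `{F ∘ Ψ⁻¹ < c} = Ψ({F < c})`. [folklore] -/
theorem setOf_comp_symm_lt (c : ℝ) : {y | (F ∘ Ψ.symm) y < c} = Ψ '' {x | F x < c} := by
  ext y; constructor
  · intro hy; exact ⟨Ψ.symm y, hy, Ψ.apply_symm_apply y⟩
  · rintro ⟨x, hx, rfl⟩; simpa [Function.comp] using hx

/-- `{c < F ∘ Ψ⁻¹} = Ψ({c < F})`. [folklore] -/
theorem setOf_comp_symm_gt (c : ℝ) : {y | c < (F ∘ Ψ.symm) y} = Ψ '' {x | c < F x} := by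
  ext y; constructor
  · intro hy; exact ⟨Ψ.symm y, hy, Ψ.apply_symm_apply y⟩
  · rintro ⟨x, hx, rfl⟩; simpa [Function.comp] using hx

/-- The height of the transported sphere is an affine function of the old height. [folklore] -/
theorem height_comp_eq {σ τ : ℝ} (hΨ : HeightAffine Ψ σ τ) :
    height (Ψ ∘ f) = fun y => σ * height f y + τ := by
  funext y
  rw [height_apply, height_apply]
  exact hΨ.2 (f y)

/-- Morse functions are stable under `h ↦ σ h + τ`, `σ = ±1`, with the same saddles.
[cite: MilnorHCobordism1965, proof of Thm. 9.1] -/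
theorem isMorse_affine {h : sphere (0 : EuclideanSpace ℝ (Fin 3)) 1 → ℝ} (hM : IsMorse (𝓡 2) h)
    {σ : ℝ} (hσ : σ = 1 ∨ σ = -1) (τ : ℝ) :
    IsMorse (𝓡 2) (fun y => σ * h y + τ) ∧
      criticalSetOfIndex (𝓡 2) (fun y => σ * h y + τ) 1 = criticalSetOfIndex (𝓡 2) h 1 := by
  have hd : ∀ y, MDifferentiableAt (𝓡 2) 𝓘(ℝ, ℝ) h y := fun y =>
    hM.contMDiff.mdifferentiableAt (by simp)
  rcases hσ with rfl | rfl
  · -- `h + τ = τ - (0 - h)`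
    have hM1 : IsMorse (𝓡 2) (fun y => (0 : ℝ) - h y) := hM.const_sub 0
    have hM2 : IsMorse (𝓡 2) (fun y => τ - ((0 : ℝ) - h y)) := hM1.const_sub τ
    have heq : (fun y => 1 * h y + τ) = fun y => τ - ((0 : ℝ) - h y) := by funext y; ring
    rw [heq]
    refine ⟨hM2, ?_⟩
    ext y
    simp only [mem_criticalSetOfIndex]
    have hd1 : MDifferentiableAt (𝓡 2) 𝓘(ℝ, ℝ) (fun y => (0 : ℝ) - h y) y :=
      hM1.contMDiff.mdifferentiableAt (by simp)
    have hc1 : IsMCriticalPt (𝓡 2) (fun y => (0 : ℝ) - h y) y ↔ IsMCriticalPt (𝓡 2) h y :=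
      isMCriticalPt_const_sub_iff 0 (hd y)
    have hc2 : IsMCriticalPt (𝓡 2) (fun y => τ - ((0 : ℝ) - h y)) y ↔
        IsMCriticalPt (𝓡 2) (fun y => (0 : ℝ) - h y) y := isMCriticalPt_const_sub_iff τ hd1
    constructor
    · rintro ⟨hc, hi⟩
      have hc' := hc2.1 hc
      have hc'' := hc1.1 hc'
      have h1 := hM1.morseIndex_const_sub_add τ hc'
      have h2 := hM.morseIndex_const_sub_add 0 hc''
      rw [finrank_euclideanSpace_fin] at h1 h2
      exact ⟨hc'', by omega⟩
    · rintro ⟨hc, hi⟩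
      have hc' := hc1.2 hc
      have hc'' := hc2.2 hc'
      have h1 := hM1.morseIndex_const_sub_add τ hc'
      have h2 := hM.morseIndex_const_sub_add 0 hc
      rw [finrank_euclideanSpace_fin] at h1 h2
      exact ⟨hc'', by omega⟩
  · -- `-h + τ = τ - h`
    have hM1 : IsMorse (𝓡 2) (fun y => τ - h y) := hM.const_sub τ
    have heq : (fun y => -1 * h y + τ) = fun y => τ - h y := by funext y; ring
    rw [heq]
    refine ⟨hM1, ?_⟩
    ext y
    simp only [mem_criticalSetOfIndex]
    have hc1 : IsMCriticalPt (𝓡 2) (fun y => τ - h y) y ↔ IsMCriticalPt (𝓡 2) h y :=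
      isMCriticalPt_const_sub_iff τ (hd y)
    constructor
    · rintro ⟨hc, hi⟩
      have hc' := hc1.1 hc
      have h1 := hM.morseIndex_const_sub_add τ hc'
      rw [finrank_euclideanSpace_fin] at h1
      exact ⟨hc', by omega⟩
    · rintro ⟨hc, hi⟩
      have h1 := hM.morseIndex_const_sub_add τ hc
      rw [finrank_euclideanSpace_fin] at h1
      exact ⟨hc1.2 hc, by omega⟩

/-- **Covariance of configurations.**  Along a height-affine diffeomorphism `Ψ` of `ℝ³`,
`(F ∘ Ψ⁻¹, Ψ ∘ f)` is a configuration whenever `(F, f)` is.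
[cite: Schultens2014, proof of Thm. 3.2.5 (PDF p. 43)] -/
theorem Config.transport (hC : Config F f) {σ τ : ℝ} (hΨ : HeightAffine Ψ σ τ) :
    Config (F ∘ Ψ.symm) (Ψ ∘ f) := by
  have hΨs : ContDiff ℝ ∞ Ψ := Ψ.contMDiff.contDiff
  have hΨis : ContDiff ℝ ∞ Ψ.symm := Ψ.symm.contMDiff.contDiff
  have hΨid : Differentiable ℝ Ψ.symm := hΨis.differentiable (by simp)
  have hΨd : Differentiable ℝ Ψ := hΨs.differentiable (by simp)
  have hFd : Differentiable ℝ F := hC.smooth.differentiable (by simp)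
  refine ⟨hC.smooth.comp hΨis, ?_, ?_, hC.emb.diffeomorph_comp Ψ, ?_, ?_, ?_, ?_⟩
  · obtain ⟨ε, hε, hK⟩ := hC.proper
    refine ⟨ε, hε, ?_⟩
    rw [setOf_comp_symm_le]
    exact hK.image Ψ.continuous
  · intro y hy h0
    have hx : F (Ψ.symm y) = 0 := hy
    apply hC.reg (Ψ.symm y) hx
    -- `F = (F ∘ Ψ⁻¹) ∘ Ψ`
    have h1 : F = (F ∘ Ψ.symm) ∘ Ψ := by ext x; simp
    have hd : DifferentiableAt ℝ (F ∘ Ψ.symm) (Ψ (Ψ.symm y)) := by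
      rw [Ψ.apply_symm_apply]; exact (hFd _).comp y (hΨid y)
    conv_lhs => rw [h1]
    rw [fderiv_comp _ hd (hΨd _), Ψ.apply_symm_apply, h0, ContinuousLinearMap.zero_comp]
  · rw [range_comp, hC.range_eq, setOf_comp_symm_eq]
  · rw [setOf_comp_symm_gt]
    exact hC.conn_pos.image Ψ Ψ.continuous.continuousOn
  · rw [setOf_comp_symm_lt]
    exact hC.conn_neg.image Ψ Ψ.continuous.continuousOn
  · rw [height_comp_eq Ψ hΨ]
    exact (isMorse_affine hC.morse hΨ.1 τ).1

/-- **The number of saddles is invariant.** [cite: MilnorHCobordism1965, proof of Thm. 9.1] -/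
theorem saddles_transport (hC : Config F f) {σ τ : ℝ} (hΨ : HeightAffine Ψ σ τ) :
    saddles (Ψ ∘ f) = saddles f := by
  unfold saddles
  rw [height_comp_eq Ψ hΨ, (isMorse_affine hC.morse hΨ.1 τ).2]

/-- Level sets correspond: `Ψ` maps `{F = 0} ∩ {x₂ = a}` onto
`{F ∘ Ψ⁻¹ = 0} ∩ {x₂ = σ a + τ}`. [folklore] -/
theorem image_level {σ τ : ℝ} (hΨ : HeightAffine Ψ σ τ) (a : ℝ) :
    Ψ '' ({x | F x = 0} ∩ {x | x 2 = a}) =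
      {y | (F ∘ Ψ.symm) y = 0} ∩ {y | y 2 = σ * a + τ} := by
  ext y; constructor
  · rintro ⟨x, ⟨hx, hxa⟩, rfl⟩
    refine ⟨by simpa [Function.comp] using hx, ?_⟩
    show (Ψ x) 2 = σ * a + τ
    rw [hΨ.2 x, show x 2 = a from hxa]
  · rintro ⟨hy, hya⟩
    refine ⟨Ψ.symm y, ⟨hy, ?_⟩, Ψ.apply_symm_apply y⟩
    have h := hΨ.2 (Ψ.symm y)
    rw [Ψ.apply_symm_apply] at h
    show (Ψ.symm y) 2 = a
    have hya' : y 2 = σ * a + τ := hya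
    rcases hΨ.1 with hσ | hσ
    · rw [hσ] at h hya'; linarith
    · rw [hσ] at h hya'; linarith

end Transport

/-! ### §2 Examples of height-affine diffeomorphisms -/

/-- The identity is height-affine. [folklore] -/
theorem heightAffine_refl :
    HeightAffine (Diffeomorph.refl 𝓘(ℝ, EuclideanSpace ℝ (Fin 3)) (EuclideanSpace ℝ (Fin 3)) ∞)
      1 0 :=
  ⟨Or.inl rfl, fun x => by simp⟩

/-- Composition of height-affine diffeomorphisms is height-affine. [folklore] -/
theorem HeightAffine.trans {Ψ₁ Ψ₂ : EuclideanSpace ℝ (Fin 3) ≃ₘ⟮𝓘(ℝ, EuclideanSpace ℝ (Fin 3)),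
    𝓘(ℝ, EuclideanSpace ℝ (Fin 3))⟯ EuclideanSpace ℝ (Fin 3)} {σ₁ τ₁ σ₂ τ₂ : ℝ}
    (h₁ : HeightAffine Ψ₁ σ₁ τ₁) (h₂ : HeightAffine Ψ₂ σ₂ τ₂) :
    HeightAffine (Ψ₁.trans Ψ₂) (σ₂ * σ₁) (σ₂ * τ₁ + τ₂) := by
  refine ⟨?_, fun x => ?_⟩
  · rcases h₁.1 with rfl | rfl <;> rcases h₂.1 with rfl | rfl <;> norm_num
  · show (Ψ₂ (Ψ₁ x)) 2 = _
    rw [h₂.2, h₁.2]; ring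

/-- The inverse of a height-affine diffeomorphism is height-affine. [folklore] -/
theorem HeightAffine.symm {Ψ : EuclideanSpace ℝ (Fin 3) ≃ₘ⟮𝓘(ℝ, EuclideanSpace ℝ (Fin 3)),
    𝓘(ℝ, EuclideanSpace ℝ (Fin 3))⟯ EuclideanSpace ℝ (Fin 3)} {σ τ : ℝ}
    (h : HeightAffine Ψ σ τ) : HeightAffine Ψ.symm σ (-(σ * τ)) := by
  refine ⟨h.1, fun x => ?_⟩
  have h2 := h.2 (Ψ.symm x)
  rw [Ψ.apply_symm_apply] at h2
  rcases h.1 with hσ | hσ <;> rw [hσ] at h2 ⊢ <;> linarith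

end Literature.Topology.FourManifolds.SchoenfliesConfig
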